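import Summits.CriticalPhenomena.PercolationContinuityZ3.Theorems.PercNearOneGluingNoHeavyPcintBSMZ5Cert
import HarnessLib

/-!
# PCINT lane, PHASE 5 (block-renewal second moment): kernel check of the meeting-probability coefficients for `ℤ^5`

Cell `prim-pcint`, seat `prim-pcint-1` (gen 14); memo `run/shared/lean/prim/pcint/T-FIBRE-ROUTE.md` §PHASE 5.
Instance `d = 5 = 2 + 3` (`k = 2` time axes, `t = 3` transverse axes), `β = 9/50` (`s = 4β = 18/25`),
horizon `N = 150`, cell `p = 1958/10^4`. `u k i · DU ≤ U_i` and `c_i · DU ≤ C_i`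
(exact rationals from the tree's `OSM.vrow`; the heaviest single kernel evaluations of the certificate, hence their own file).
-/

namespace Summit.CriticalPhenomena.PercolationContinuityZ3.Theorems.Pcint.BSM.Z5

open Summit.CriticalPhenomena.PercolationContinuityZ3.Theorems.Pcint.BSM

set_option maxHeartbeats 0 in
set_option maxRecDepth 65536 in
/-- `u k i · DU ≤ U_i`. -/
theorem hU : ∀ i ∈ List.range NN, uqv (OSM.vrow kk NN) kk i * DU ≤ (Ul.getD i 0 : ℚ) := by
  decide +kernel

set_option maxHeartbeats 0 in
set_option maxRecDepth 65536 in
/-- `c_i · DU ≤ C_i`. -/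
theorem hC : ∀ i ∈ List.range NN, cadjqv (OSM.vrow kk (NN + 1)) kk i * DU ≤ (Cl.getD i 0 : ℚ) := by
  decide +kernel

end Summit.CriticalPhenomena.PercolationContinuityZ3.Theorems.Pcint.BSM.Z5
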